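import Mathlib.Combinatorics.SetFamily.Compression.Down
import Mathlib.Tactic
import HarnessLib
import HarnessLib.Audit.Tags
import Summits.CriticalPhenomena.PercolationContinuityZ3.Theorems.PercNearOneGluingNoHeavyLowerTailSahiRainbowTwoColourDeficitDefs

/-!
# The sparse residual is LOCAL, V: shared bisection members; two D-points (DD)

Support file (seat `prim-masterthm-p1`, gen 42; `--supports stmt-CriticalPhenomena-4575`).  No `sorry`, standard axioms.
Blueprint `run/shared/lean/prim/prim-masterthm/FROM-prim-masterthm-p1-g42-*.md` (PROOFS §4–§5).

SETTING (`…SahiRainbowTwoColourDeficitDefs`): `Z = K ⊔ K' ⊆ 2^G` complement-closed (colour classes in either order),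
`L = monoMeets K K'`; monochromatic bisections `Bisect C Z G y A A'` (`A, A' ∈ C`, `A ∩ A' = {y}`, `A ∪ A' = G`, lower
members in `Z`); D-points `DAt` (a `K`- and a `K'`-bisection, `{y} ∈ L`, no non-empty twin) and Q-points `Q3At K K'`
(`{y} ∈ K`, `G ∈ K'`, `G ∖ y ∈ Z`, a `K`-bisection, no non-empty twin).

THIS FILE (S₂ versus S₂, first half):
* `Bisect.shared` (**SHARED**): same-colour bisections at two points without non-empty twins, the member at `y₁` through `y₂`
  and the member at `y₂` through `y₁` COINCIDE;
* `Bisect.dd` (**DD**): two D-points whose bisections share `A ∈ K` and `B ∈ K'` satisfy `A ∩ B = {{y₁, y₂}}`, `A ∪ B = G`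
  (`dd_engine`: the twins `A ∖ B`, `B ∖ A`, `A ∖ {{y₁,y₂}}` at the two points; `shared_erase_both`).
HONEST FRAMING: unconditional combinatorial lemmas (the local three-direction analysis of the sparse residual). [this work]
-/

namespace Summit.CriticalPhenomena.PercolationContinuityZ3.Theorems.SahiColouredDaykin

open Finset
open scoped FinsetFamily

variable {α : Type*} [DecidableEq α]

/-! ### 1. Shared bisection members -/

section Shared

variable {K K' : Finset (Finset α)} {G : Finset α} {y₁ y₂ : α} {A₁ A₁' A₂ A₂' : Finset α}

/-- The complement of a bisection member is a (lower) member. [this work] -/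
theorem Bisect.sdiff_mem {C Z : Finset (Finset α)} {y : α} {A A' : Finset α} (h : Bisect C Z G y A A') :
    G \ A ∈ Z := by
  have := h.erase_mem'
  rwa [h.eq_insert_sdiff, erase_insert (fun h' => (mem_sdiff.1 h').2 h.y_mem)] at this

/-- **SHARED.**  Monochromatic `K`-bisections at two points with no non-empty twins, the member at `y₁` containing `y₂` and
the member at `y₂` containing `y₁`: these members coincide. [this work] -/
theorem Bisect.shared (hA₁ : Bisect K (K ∪ K') G y₁ A₁ A₁') (hA₂ : Bisect K (K ∪ K') G y₂ A₂ A₂') (hne : y₁ ≠ y₂)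
    (hy₂ : y₂ ∈ A₁) (hy₁ : y₁ ∈ A₂) (htw₁ : NoTwin (monoMeets K K') y₁) (htw₂ : NoTwin (monoMeets K K') y₂) :
    A₁ = A₂ := by
  by_contra hne12
  -- Step 1: the lower members `A_i ∖ y_i` have colour `K'`
  have low : ∀ {y y' : α} {A A' B B' : Finset α}, Bisect K (K ∪ K') G y A A' → Bisect K (K ∪ K') G y' B B' → y ≠ y' →
      y' ∈ A → y ∈ B → A ≠ B → NoTwin (monoMeets K K') y' → B.erase y' ∈ K' := by
    intro y y' A A' B B' hA hB hyy' hy'A hyB hAB htw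
    rcases mem_union.1 hB.erase_mem with hK | hK'
    swap
    · exact hK'
    exfalso
    have ne1 : A ≠ B.erase y' := fun e => (notMem_erase y' B) (e ▸ hy'A)
    have c_mem : A ∩ B.erase y' ∈ monoMeets K K' := inter_mem_monoMeets_left hA.mem hK ne1
    have c'_mem : A ∩ B ∈ monoMeets K K' := inter_mem_monoMeets_left hA.mem hB.mem hAB
    rw [← insert_erase hB.y_mem, inter_insert_of_mem hy'A] at c'_mem
    have hc := htw c_mem c'_mem (fun h => (notMem_erase y' B) (mem_inter.1 h).2)
    have : y ∈ A ∩ B.erase y' := mem_inter.2 ⟨hA.y_mem, mem_erase.2 ⟨hyy', hyB⟩⟩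
    rw [hc] at this; exact notMem_empty _ this
  have l2 : A₂.erase y₂ ∈ K' := low hA₁ hA₂ hne hy₂ hy₁ hne12 htw₂
  have l1 : A₁.erase y₁ ∈ K' := low hA₂ hA₁ hne.symm hy₁ hy₂ (Ne.symm hne12) htw₁
  -- Step 2: mutual inclusion
  have incl : ∀ {y y' : α} {A A' B B' : Finset α}, Bisect K (K ∪ K') G y A A' → Bisect K (K ∪ K') G y' B B' → y ≠ y' →
      y' ∈ A → y ∈ B → A.erase y ∈ K' → NoTwin (monoMeets K K') y' → A ⊆ B := by
    intro y y' A A' B B' hA hB hyy' hy'A hyB hlow htw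
    by_contra hsub
    obtain ⟨t, htA, htB⟩ := not_subset.1 hsub
    have hyGB : y ∉ G \ B := fun h => (mem_sdiff.1 h).2 hyB
    have hy'GB : y' ∉ G \ B := fun h => (mem_sdiff.1 h).2 hB.y_mem
    have neAB' : A ≠ B' := by
      intro e; have := hA.y_mem; rw [e, hB.mem'_iff] at this
      rcases this with h | h
      · exact hyy' h
      · exact h.2 hyB
    have c'_mem : A ∩ B' ∈ monoMeets K K' := inter_mem_monoMeets_left hA.mem hB.mem' neAB'
    rw [hB.eq_insert_sdiff, inter_insert_of_mem hy'A] at c'_mem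
    have c_mem : A ∩ (G \ B) ∈ monoMeets K K' := by
      rcases mem_union.1 hB.sdiff_mem with hK | hK'
      · exact inter_mem_monoMeets_left hA.mem hK (fun e => hy'GB (e ▸ hy'A))
      · have ne : A.erase y ≠ G \ B := fun e => hy'GB (e ▸ mem_erase.2 ⟨hyy'.symm, hy'A⟩)
        have := inter_mem_monoMeets_right (X := K) hlow hK' ne
        rwa [erase_inter, erase_eq_of_notMem (fun h => hyGB (mem_inter.1 h).2)] at this
    have hc := htw c_mem c'_mem (fun h => hy'GB (mem_inter.1 h).2)
    have : t ∈ A ∩ (G \ B) := mem_inter.2 ⟨htA, mem_sdiff.2 ⟨hA.subset htA, htB⟩⟩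
    rw [hc] at this; exact notMem_empty _ this
  have i1 : A₁ ⊆ A₂ := incl hA₁ hA₂ hne hy₂ hy₁ l1 htw₂
  have i2 : A₂ ⊆ A₁ := incl hA₂ hA₁ hne.symm hy₁ hy₂ l2 htw₁
  exact hne12 (Subset.antisymm i1 i2)

end Shared

/-! ### 2. Two D-points: the shared members cross in `{y₁, y₂}` -/

section DD

variable {K K' : Finset (Finset α)} {G : Finset α} {y₁ y₂ : α} {A A₁' A₂' B B₁' B₂' : Finset α}

/-- Twin bookkeeping used twice below: if both lower members `A ∖ y₁`, `A ∖ y₂` of a shared `K`-member have colour `K`,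
then `A = {y₁, y₂}`. [this work] -/
theorem shared_erase_both (hAK : A ∈ K) (hy₁ : y₁ ∈ A) (hy₂ : y₂ ∈ A) (hne : y₁ ≠ y₂) (h1 : A.erase y₁ ∈ K)
    (h2 : A.erase y₂ ∈ K) (htw₁ : NoTwin (monoMeets K K') y₁) : A = {y₁, y₂} := by
  have ne1 : A.erase y₁ ≠ A.erase y₂ := by
    intro e; have : y₂ ∈ A.erase y₁ := mem_erase.2 ⟨hne.symm, hy₂⟩
    rw [e] at this; exact (notMem_erase y₂ A) this
  have c_mem : A.erase y₁ ∩ A.erase y₂ ∈ monoMeets K K' := inter_mem_monoMeets_left h1 h2 ne1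
  have ne2 : A ≠ A.erase y₂ := fun e => (notMem_erase y₂ A) (e ▸ hy₂)
  have c'_mem : A ∩ A.erase y₂ ∈ monoMeets K K' := inter_mem_monoMeets_left hAK h2 ne2
  have e1 : A ∩ A.erase y₂ = insert y₁ (A.erase y₁ ∩ A.erase y₂) := by
    ext t; simp only [mem_inter, mem_erase, mem_insert]
    constructor
    · rintro ⟨htA, ht2, -⟩
      by_cases h : t = y₁
      · exact Or.inl h
      · exact Or.inr ⟨⟨h, htA⟩, ht2, htA⟩
    · rintro (rfl | ⟨⟨-, htA⟩, ht2, -⟩)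
      · exact ⟨hy₁, hne, hy₁⟩
      · exact ⟨htA, ht2, htA⟩
  rw [e1] at c'_mem
  have hc := htw₁ c_mem c'_mem (fun h => (notMem_erase y₁ A) (mem_inter.1 h).1)
  -- `A ∖ {y₁, y₂} = ∅`
  ext t; simp only [mem_insert, mem_singleton]
  constructor
  · intro ht
    by_contra h; push Not at h
    have : t ∈ A.erase y₁ ∩ A.erase y₂ := mem_inter.2 ⟨mem_erase.2 ⟨h.1, ht⟩, mem_erase.2 ⟨h.2, ht⟩⟩
    rw [hc] at this; exact notMem_empty _ this
  · rintro (rfl | rfl); exacts [hy₁, hy₂]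

/-- The structure `S` as one equation: `A ∖ y' = insert y (G ∖ B)` gives `A ∩ B = {y, y'}` and `A ∪ B = G`. [this work] -/
theorem dd_concl {y y' : α} {A B : Finset α} (hyA : y ∈ A) (hy'A : y' ∈ A) (hyB : y ∈ B) (hy'B : y' ∈ B)
    (hAG : A ⊆ G) (hBG : B ⊆ G) (e : A.erase y' = insert y (G \ B)) : A ∩ B = {y, y'} ∧ A ∪ B = G := by
  have key : ∀ t, t ≠ y' → (t ∈ A ↔ t = y ∨ (t ∈ G ∧ t ∉ B)) := by
    intro t ht
    have := congrArg (t ∈ ·) e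
    simp only [mem_erase, mem_insert, mem_sdiff, eq_iff_iff] at this
    constructor
    · intro htA; exact this.1 ⟨ht, htA⟩
    · intro h; exact (this.2 h).2
  constructor
  · ext t; simp only [mem_inter, mem_insert, mem_singleton]
    constructor
    · rintro ⟨htA, htB⟩
      by_cases ht : t = y'
      · exact Or.inr ht
      · rcases (key t ht).1 htA with h | h
        · exact Or.inl h
        · exact absurd htB h.2
    · rintro (rfl | rfl); exacts [⟨hyA, hyB⟩, ⟨hy'A, hy'B⟩]
  · ext t; simp only [mem_union]
    constructor
    · rintro (h | h); exacts [hAG h, hBG h]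
    · intro htG
      by_cases ht : t = y'
      · exact Or.inl (ht ▸ hy'A)
      · by_cases htB : t ∈ B
        · exact Or.inr htB
        · exact Or.inl ((key t ht).2 (Or.inr ⟨htG, htB⟩))

/-- **DD engine.**  Shared `K`-member `A` and shared `K'`-member `B` at the D-points `y ≠ y'`; if the lower member
`A ∖ y'` has colour `K'` then either the structure `S` holds (in one of its two orientations) or `A = {y, y'}`. [this work] -/
theorem dd_engine {K K' : Finset (Finset α)} {y y' : α} {A A' Ay' B B' By' : Finset α} (hKK' : Disjoint K K')
    (hA : Bisect K (K ∪ K') G y A A') (hA' : Bisect K (K ∪ K') G y' A Ay') (hB : Bisect K' (K ∪ K') G y B B')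
    (hB' : Bisect K' (K ∪ K') G y' B By') (hyy' : y ≠ y') (htw : NoTwin (monoMeets K K') y)
    (htw' : NoTwin (monoMeets K K') y') (hlow : A.erase y' ∈ K') :
    A.erase y' = insert y (G \ B) ∨ A = {y, y'} ∨ B.erase y = insert y' (G \ A) := by
  have hyA := hA.y_mem; have hy'A := hA'.y_mem; have hyB := hB.y_mem; have hy'B := hB'.y_mem
  have hAB : A ≠ B := fun e => disjoint_left.1 hKK' hA.mem (e ▸ hB.mem)
  have hyGB : y ∉ G \ B := fun h => (mem_sdiff.1 h).2 hyB
  have hy'GB : y' ∉ G \ B := fun h => (mem_sdiff.1 h).2 hy'B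
  -- D2: `A ⊆ B` or `S`
  by_cases hS : A.erase y' = insert y (G \ B)
  · exact Or.inl hS
  have hAB_sub : A ⊆ B := by
    by_contra hsub
    obtain ⟨t, htA, htB⟩ := not_subset.1 hsub
    have ne1 : A.erase y' ≠ B' := by rw [hB.eq_insert_sdiff]; exact hS
    have ne2 : A.erase y' ≠ By' := fun e => (notMem_erase y' A) (e ▸ hB'.y_mem')
    have c_mem : A.erase y' ∩ By' ∈ monoMeets K K' := inter_mem_monoMeets_right hlow hB'.mem' ne2
    have c'_mem : A.erase y' ∩ B' ∈ monoMeets K K' := inter_mem_monoMeets_right hlow hB.mem' ne1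
    have e1 : A.erase y' ∩ By' = A ∩ (G \ B) := by
      rw [hB'.eq_insert_sdiff, inter_insert_of_notMem (notMem_erase y' A), erase_inter,
        erase_eq_of_notMem (fun h => hy'GB (mem_inter.1 h).2)]
    have e2 : A.erase y' ∩ B' = insert y (A ∩ (G \ B)) := by
      rw [hB.eq_insert_sdiff, inter_insert_of_mem (mem_erase.2 ⟨hyy', hyA⟩), erase_inter,
        erase_eq_of_notMem (fun h => hy'GB (mem_inter.1 h).2)]
    rw [e1] at c_mem; rw [e2] at c'_mem
    have hc := htw c_mem c'_mem (fun h => hyGB (mem_inter.1 h).2)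
    have : t ∈ A ∩ (G \ B) := mem_inter.2 ⟨htA, mem_sdiff.2 ⟨hA.subset htA, htB⟩⟩
    rw [hc] at this; exact notMem_empty _ this
  -- D3: `A ⊆ B`
  rcases mem_union.1 hB.erase_mem with hBK | hBK'
  · -- `B ∖ y ∈ K`: twin `B ∖ A` at `y'` unless `S'`
    by_cases hS' : B.erase y = insert y' (G \ A)
    · exact Or.inr (Or.inr hS')
    exfalso
    have hyGA : y ∉ G \ A := fun h => (mem_sdiff.1 h).2 hyA
    have ne1 : B.erase y ≠ Ay' := by rw [hA'.eq_insert_sdiff]; exact hS'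
    have ne2 : B.erase y ≠ A' := fun e => (notMem_erase y B) (e ▸ hA.y_mem')
    have c_mem : B.erase y ∩ A' ∈ monoMeets K K' := inter_mem_monoMeets_left hBK hA.mem' ne2
    have c'_mem : B.erase y ∩ Ay' ∈ monoMeets K K' := inter_mem_monoMeets_left hBK hA'.mem' ne1
    have e1 : B.erase y ∩ A' = B ∩ (G \ A) := by
      rw [hA.eq_insert_sdiff, inter_insert_of_notMem (notMem_erase y B), erase_inter,
        erase_eq_of_notMem (fun h => hyGA (mem_inter.1 h).2)]
    have e2 : B.erase y ∩ Ay' = insert y' (B ∩ (G \ A)) := by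
      rw [hA'.eq_insert_sdiff, inter_insert_of_mem (mem_erase.2 ⟨hyy'.symm, hy'B⟩), erase_inter,
        erase_eq_of_notMem (fun h => hyGA (mem_inter.1 h).2)]
    rw [e1] at c_mem; rw [e2] at c'_mem
    have hc := htw' c_mem c'_mem (fun h => (mem_sdiff.1 (mem_inter.1 h).2).2 hy'A)
    have : B ⊆ A := by
      intro t htB; by_contra htA
      have : t ∈ B ∩ (G \ A) := mem_inter.2 ⟨htB, mem_sdiff.2 ⟨hB.subset htB, htA⟩⟩
      rw [hc] at this; exact notMem_empty _ this
    exact hAB (Subset.antisymm hAB_sub this)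
  · -- `B ∖ y ∈ K'`: twin `A ∖ {y, y'}` at `y` unless `A = {y, y'}`
    have ne1 : A.erase y' ≠ B.erase y := by
      intro e; have : y ∈ A.erase y' := mem_erase.2 ⟨hyy', hyA⟩
      rw [e] at this; exact (notMem_erase y B) this
    have ne2 : A.erase y' ≠ B := fun e => (notMem_erase y' A) (e ▸ hy'B)
    have c_mem : A.erase y' ∩ B.erase y ∈ monoMeets K K' := inter_mem_monoMeets_right hlow hBK' ne1
    have c'_mem : A.erase y' ∩ B ∈ monoMeets K K' := inter_mem_monoMeets_right hlow hB.mem ne2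
    have eA : A.erase y' ∩ B = A.erase y' := inter_eq_left.2 ((erase_subset _ _).trans hAB_sub)
    have e1 : A.erase y' ∩ B.erase y = (A.erase y').erase y := by rw [inter_erase, eA]
    rw [e1] at c_mem
    rw [eA, ← insert_erase (mem_erase.2 ⟨hyy', hyA⟩ : y ∈ A.erase y')] at c'_mem
    have hc := htw c_mem c'_mem (notMem_erase _ _)
    right; left
    ext t; simp only [mem_insert, mem_singleton]
    constructor
    · intro ht; by_contra h; push Not at h
      have : t ∈ (A.erase y').erase y := mem_erase.2 ⟨h.1, mem_erase.2 ⟨h.2, ht⟩⟩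
      rw [hc] at this; exact notMem_empty _ this
    · rintro (rfl | rfl); exacts [hyA, hy'A]

/-- **DD.**  Two D-points `y₁ ≠ y₂` whose `K`-bisections share the member `A` and whose `K'`-bisections share `B`: then
`A ∩ B = {y₁, y₂}` and `A ∪ B = G`. [this work] -/
theorem Bisect.dd (hKK' : Disjoint K K') (hA₁ : Bisect K (K ∪ K') G y₁ A A₁') (hA₂ : Bisect K (K ∪ K') G y₂ A A₂')
    (hB₁ : Bisect K' (K ∪ K') G y₁ B B₁') (hB₂ : Bisect K' (K ∪ K') G y₂ B B₂') (hne : y₁ ≠ y₂)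
    (htw₁ : NoTwin (monoMeets K K') y₁) (htw₂ : NoTwin (monoMeets K K') y₂) :
    A ∩ B = {y₁, y₂} ∧ A ∪ B = G := by
  have hy₁A := hA₁.y_mem; have hy₂A := hA₂.y_mem; have hy₁B := hB₁.y_mem; have hy₂B := hB₂.y_mem
  have hAG := hA₁.subset; have hBG := hB₁.subset
  have hAB : A ≠ B := fun e => disjoint_left.1 hKK' hA₁.mem (e ▸ hB₁.mem)
  have htw₁' : NoTwin (monoMeets K' K) y₁ := by rw [monoMeets_comm]; exact htw₁
  have htw₂' : NoTwin (monoMeets K' K) y₂ := by rw [monoMeets_comm]; exact htw₂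
  have e := union_comm K K'
  -- the four ways the structure can be delivered
  have c12 := fun (h : A.erase y₂ = insert y₁ (G \ B)) => dd_concl hy₁A hy₂A hy₁B hy₂B hAG hBG h
  have c21 : A.erase y₁ = insert y₂ (G \ B) → A ∩ B = {y₁, y₂} ∧ A ∪ B = G := fun h => by
    have := dd_concl hy₂A hy₁A hy₂B hy₁B hAG hBG h; rwa [pair_comm] at this
  have d12 : B.erase y₂ = insert y₁ (G \ A) → A ∩ B = {y₁, y₂} ∧ A ∪ B = G := fun h => by
    have := dd_concl hy₁B hy₂B hy₁A hy₂A hBG hAG h; rwa [inter_comm, union_comm] at this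
  have d21 : B.erase y₁ = insert y₂ (G \ A) → A ∩ B = {y₁, y₂} ∧ A ∪ B = G := fun h => by
    have := dd_concl hy₂B hy₁B hy₂A hy₁A hBG hAG h; rwa [inter_comm, union_comm, pair_comm] at this
  -- case `A = {y₁, y₂}`: run the engine on the `B`-side
  have caseA : A = {y₁, y₂} → A ∩ B = {y₁, y₂} ∧ A ∪ B = G := by
    intro hA
    rcases mem_union.1 hB₂.erase_mem with h2K | h2K'
    · rcases dd_engine hKK'.symm (hB₁.of_eq e) (hB₂.of_eq e) (hA₁.of_eq e) (hA₂.of_eq e) hne htw₁' htw₂' h2K with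
        h | h | h
      · exact d12 h
      · exact absurd (hA.trans h.symm) hAB
      · exact c21 h
    rcases mem_union.1 hB₁.erase_mem with h1K | h1K'
    · rcases dd_engine hKK'.symm (hB₂.of_eq e) (hB₁.of_eq e) (hA₂.of_eq e) (hA₁.of_eq e) hne.symm htw₂' htw₁' h1K
        with h | h | h
      · exact d21 h
      · rw [pair_comm] at h; exact absurd (hA.trans h.symm) hAB
      · exact c12 h
    have := shared_erase_both hB₁.mem hy₁B hy₂B hne h1K' h2K' htw₁'
    exact absurd (hA.trans this.symm) hAB
  rcases mem_union.1 hA₂.erase_mem with h2K | h2K'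
  swap
  · rcases dd_engine hKK' hA₁ hA₂ hB₁ hB₂ hne htw₁ htw₂ h2K' with h | h | h
    · exact c12 h
    · exact caseA h
    · exact d21 h
  rcases mem_union.1 hA₁.erase_mem with h1K | h1K'
  swap
  · rcases dd_engine hKK' hA₂ hA₁ hB₂ hB₁ hne.symm htw₂ htw₁ h1K' with h | h | h
    · exact c21 h
    · rw [pair_comm] at h; exact caseA h
    · exact d12 h
  exact caseA (shared_erase_both hA₁.mem hy₁A hy₂A hne h1K h2K htw₁)

end DD

end Summit.CriticalPhenomena.PercolationContinuityZ3.Theorems.SahiColouredDaykin
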